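import Summits.BirchSwinnertonDyer.BirchSwinnertonDyer.Theorems.PrintX11aUpperNonSurjThreeEngineWithoutGZK
import Summits.BirchSwinnertonDyer.BirchSwinnertonDyer.Theorems.ErratumRoadFiveNonSurjCornerTwinMuAnUnitValue
import Summits.BirchSwinnertonDyer.BirchSwinnertonDyer.Theorems.PrintX11aUpperNonSurjFiveCartanDescent
import Literature.NumberTheory.EllipticCurves.MazurTorsionGaloisStructureProofs
import HarnessLib

/-!
# Route `PrintX11a`, crux U5 = `Theses.PrintX11a.UpperNonSurjFive` (item stmt-BirchSwinnertonDyer-20614), line of record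
# «gl1cartan5»: the UNIT SECTOR of U5 per pair and class-free from the cell's μ-road (eight print-exact facts), the hard-locus
# door with the analytic certificate explicit, and the headline of line «cmvalue5» REV 4 as a corollary — route-file-free module

Cell `bsd-print-x11a`, LEAD `cruxlead-stmt-BirchSwinnertonDyer-20614` g4 (integration of the evidence on item 20614 at the g4 re-seat:
line «cmvalue5» REV 4, bsd-idea-6 g9, evidence #51–54; `--supports stmt-BirchSwinnertonDyer-20614 --as helper`).  THEOREMS ONLY: no
definition, no named fact minted, no `sorry`; every theorem is CONDITIONAL on named published facts displayed as hypotheses; item 20614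
is NOT closed by this file and nothing is asserted about any curve.  This module does not import the route file (theses-cone hygiene);
its companion `Theorems/PrintX11aUpperNonSurjFiveCoreResiduals.lean` glues it to the crux BY NAME.

THE POINT.  At a NON-split multiplicative `p` with `L(E,1)/Ω_E = t` of `p`-adic valuation `0`, the constant coefficient `2t` of the
Néron-normalised Mazur–Tate–Teitelbaum function `ϖ·L_p(f_E)` is a `p`-adic unit — the analytic `μ`-certificate at level `0`
(`X11b.MuAnUnit.exists_norm_coeff_eq_one_of_neg_one_of_padicValRat_eq_zero`, corner-p1 g7).  The cell's μ-road WITHOUT big image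
(`X11b.multDivisibilityAt_of_katoFacts_of_muAn_contra_of_mazur`: unit coefficient ⟹ `μ(X(E/ℚ_∞)) = 0` ⟹ integral membership; then the
rank-`0` engine `X11b.missingUpperBoundAt_of_multDivisibilityAt_of_analyticRank_eq_zero_noGZK`) turns it into the Euler half
`Typed.MissingUpperBoundAt W p`, modulo EIGHT print-exact named facts: Stein–Wuthrich 2013 Thm. 6.1 ×2, Kato 2004 Thm. 12.4, modularity
(`exists_isNewformOf`), Kato §17.13 construction facts V′ ∕ VI′ ∕ XI′ (`…_contra`), Mazur 1978 Cor. 4.1; Kato (12.2.1) is the tree theorem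
`Kato2004.nonempty_iwasawaH1Data_holds`.  This is the two halves of x11a-p3 g6's per-pair door
`ClassX11a.missingUpperBoundAt_of_not_surj_of_hardCert_of_nineFacts` (`Theorems/PrintX11aUpperNonSurjFiveOfNineFacts.lean`, a module on
the route file) restated route-file-free and SPLIT INTO ITS TWO CASES:

* §1 `ClassX11a.missingUpperBoundAt_of_not_surj_of_nonsplit_of_unitValue_contra` — OFF the hard locus (`p` non-split, `ord_p t = 0`):
  no certificate asked; and the class-free binder form `GL1Cartan.upperNonSurjFive_on_unitSector_of_eightFacts` («∀ pairs of U5 on the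
  unit sector») used by the record's rev-9 composition.
* §2 `ClassX11a.missingUpperBoundAt_of_not_surj_of_muCert_contra` — ANYWHERE, from an analytic `μ`-certificate AT THE PAIR (some
  coefficient of `ϖ·L_p` a unit, for the allowable root) and — only at a split `p` — Greenberg–Stevens at the pair; this is what the
  registered rung `Theorems.X11aNonSurjMuAnHardFive` supplies on the hard locus.
* §3 `GL1Cartan.padicValRat_shaAn_eq_padicValRat_LOne_div` (`ord_p #Ш_an = ord_p (L(E,1)/Ω_E)` on X11a with no split multiplicative
  prime: `p ∤ #E(ℚ)` by irreducibility — Mazur 1977 III §5 via `not_exists_addOrderOf_eq_of_hasIrreducibleModPGaloisRep` — and `p ∤ ∏ c_ℓ`)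
  and `GL1Cartan.noPTorsion_on_unitSector_of_nineFacts`: **the headline `UnitSectorNoPTorsion` of line «cmvalue5» REV 4** («X11a, `5 ≤ p`,
  main locus ∧ no multiplicative `ℓ ≡ −1 (p)` ∧ `p ∤ #Ш_an` ⟹ `Ш(E/ℚ)[p] = 0`») as a COROLLARY on the LARGER locus «no split multiplicative
  prime ∧ `p ∤ #Ш_an`», modulo the eight facts + Gross–Zagier–Kolyvagin — no Cartan datum, no `ℓ ≢ −1` clause, no CM value transport,
  no twist-existence stub: `ord_p #Ш ≤ ord_p #Ш_an = 0` and a finite `Ш` with `ord_p #Ш = 0` has no `p`-torsion.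

HONEST FRAMING.  Off the unit sector nothing is claimed; the class-wide statement U5 stays open (Greenberg's analytic `μ = 0` on the
hard locus; barrier `EulerSystemBigImageAtSmallImage`).  The leaf `ClassX11a` is not closed; no statement of the summit is proved; BSD is
not proved by any of this and nothing here bounds a non-trivial `Ш`.  «beyond-print theorem: NO» (re-plumbing of landed theorems).

References: [MazurTateTeitelbaum1986] §I.10, §I.14; [Kato2004Asterisque] Thm. 12.4 (p. 221), §17.13 (pp. 279–280); [SteinWuthrich2013]
Thm. 6.1 (p. 20); [Kobayashi2006DocMath] Cor. 4.2 (p. 575); [Wuthrich2014] Cor. 18 (p. 398); [Mazur1978] Cor. 4.1; [Mazur1977] Ch. III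
§5 (p. 157); [Miller2011LMS] Def. 1.1 (arXiv:1010.2431 p. 3); [SilvermanATAEC1994] Cor. IV.9.2 (d); [GreenbergLNM1716] §1 Conj. 1.11 (p. 62).
-/

-- justified: the file namespace `Summit.BirchSwinnertonDyer.BirchSwinnertonDyer.Theorems.GL1Cartan` repeats the sub-problem segment by the D-0017 layout
set_option linter.dupNamespace false
set_option autoImplicit false

noncomputable section

open scoped Classical NumberField MatrixGroups ModularForm

open CongruenceSubgroup WeierstrassCurve
  Literature.NumberTheory.EllipticCurves
  Literature.NumberTheory.EllipticCurves.ModularForms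
  Literature.NumberTheory.EllipticCurves.Rank1Residual
  Literature.NumberTheory.EllipticCurves.Rank1Residual.Typed
  Literature.NumberTheory.EllipticCurves.SteinWuthrich2013
  Literature.NumberTheory.EllipticCurves.Kato2004
  Literature.NumberTheory.EllipticCurves.Wuthrich2014
  Summit.BirchSwinnertonDyer.Rank1Residual
  Summit.BirchSwinnertonDyer.Rank1Residual.X11b

/-! ## §1 Off the hard locus: `p` non-split, `L(E,1)/Ω_E` a `p`-adic unit — no certificate asked -/

namespace Summit.BirchSwinnertonDyer.Rank1Residual.ClassX11a

/-- **Unit-value door, print-exact facts (per pair).**  At an X11a pair `(W, p)` (`r_an = 0`, `p ∥ N` odd, `E[p]` irreducible) with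
`ρ̄_{E,p}` NOT surjective, `p` NON-split multiplicative and `L(E,1)/Ω_E = t` with `ord_p t = 0`: `Typed.MissingUpperBoundAt W p`, granted
the eight facts.  The constant coefficient `2·ϖ·[0]⁺_f = 2t` of `ϖ·L_p` is the analytic `μ`-certificate; Greenberg–Stevens is vacuous at a
non-split prime.  (The `_contra`-facts form of p539522 §6 `x11a_missingUpperBoundAt_of_not_surj_of_nonsplit_of_unit_value`; the unit
case of x11a-p3 g6's fold-in.) -- adapted from Theorems/PrintX11aUpperNonSurjFiveOfNineFacts.lean §1 (off-hard-locus branch)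
[cite: MazurTateTeitelbaum1986, §I.10 and §I.14] [cite: Kato2004Asterisque, Thm. 12.4 (p. 221) and §17.13 (pp. 279–280)]
[cite: SteinWuthrich2013, Thm. 6.1 (p. 20)] [cite: Mazur1978, Cor. 4.1] -/
theorem missingUpperBoundAt_of_not_surj_of_nonsplit_of_unitValue_contra
    (hJs : thm61_splitMultiplicative) (hJn : thm61_nonsplitMultiplicative)
    (h12 : Kato2004.thm12_4) (hnf : exists_isNewformOf)
    (hns' : Kato2004.exists_multDivisibilityInputs_nonsplit_contra)
    (hsp' : Kato2004.exists_multDivisibilityInputs_split_contra)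
    (hfine' : Kato2004.exists_multDivisibilityInputs_fine_contra) (hMz : mazur_not_dvd_maninConstant_of_odd)
    (W : WeierstrassCurve ℚ) [W.IsElliptic] [W.IsGloballyMinimal] (p : ℕ) [Fact p.Prime]
    (hX : ClassX11a W p) (hns : ¬ Surj W p) (hnsp : ¬ W.HasSplitMultiplicativeReductionAtPrime p)
    {t : ℚ} (ht : W.entireLFunction 1 / (W.realPeriodRat : ℂ) = (t : ℂ)) (hunit : padicValRat p t = 0) :
    Typed.MissingUpperBoundAt W p := by
  have hp2 : p ≠ 2 := hX.ne_two
  have hmod : hasEntireLFunction_rat := WeierstrassCurve.hasEntireLFunction_rat_of_exists_isNewformOf hnf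
  have hL1 : W.entireLFunction 1 ≠ 0 := hX.L_one_ne_zero hmod
  have hΩC : (W.realPeriodRat : ℂ) ≠ 0 := Complex.ofReal_ne_zero.mpr W.realPeriodRat_pos_holds.ne'
  have ht0 : t ≠ 0 := by
    rintro rfl
    apply hL1
    rw [← div_mul_cancel₀ (W.entireLFunction 1) hΩC, ht]
    simp
  refine missingUpperBoundAt_of_multDivisibilityAt_of_analyticRank_eq_zero_noGZK hJs hJn hnf W p
    (fun hsp => absurd hsp hnsp) hp2 hX.mult hX.analyticRank_eq_zero ?_
  refine multDivisibilityAt_of_katoFacts_of_muAn_contra_of_mazur nonempty_iwasawaH1Data_holds h12 hnf hns' hsp'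
    hfine' hMz W p hp2 hX.mult hX.irr hns ?_
  intro N _ f hf ϖ hϖ a L _ hna hL
  have ha : a = -1 := hna hnsp
  subst ha
  -- `ϖ · [0]⁺_f = L(E,1)/Ω_E = t`
  have hLval : W.entireLFunction 1 = ((((ratPlusSymbol f 0 : ℚ) : ℝ) * plusPeriod f : ℝ) : ℂ) :=
    hf.entireLFunction_one_eq
  have hq : W.entireLFunction 1 / (W.realPeriodRat : ℂ) = (((ϖ * ratPlusSymbol f 0 : ℚ)) : ℂ) := by
    rw [hLval, ← hϖ, div_eq_iff hΩC]
    push_cast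
    ring
  have hteq : ϖ * ratPlusSymbol f 0 = t := by
    have h := ht.symm.trans hq
    exact_mod_cast h.symm
  exact MuAnUnit.exists_norm_coeff_eq_one_of_neg_one_of_padicValRat_eq_zero hp2 hL ϖ (hteq ▸ ht0) (hteq ▸ hunit)

/-! ## §2 Anywhere, from an analytic `μ`-certificate at the pair (the rung's conclusion at the pair) -/

/-- **`μ`-certificate door, print-exact facts (per pair).**  At an X11a pair `(W, p)` with `ρ̄_{E,p}` NOT surjective, an analytic
`μ`-certificate AT THE PAIR — for every newform `f` of `W`, period ratio `ϖ` and Mazur–Tate–Teitelbaum function `L` with the allowable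
root (`1` split, `−1` non-split), some coefficient of `ϖ·L` is a `p`-adic unit — gives `Typed.MissingUpperBoundAt W p`, granted the eight
facts and, only when `p` is split, the exceptional-zero formula at the pair.  On the hard locus this certificate is exactly what the
registered rung `Theorems.X11aNonSurjMuAnHardFive` asserts; per pair it is the cell's coset-table computation (`X11a.muAnZeroAt_of_cosetTable`).
-- adapted from Theorems/PrintX11aUpperNonSurjFiveOfNineFacts.lean §1 (hard-locus branch, guard removed)
[cite: Kato2004Asterisque, Thm. 12.4 (p. 221) and §17.13 (pp. 279–280)] [cite: SteinWuthrich2013, Thm. 6.1 (p. 20)]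
[cite: Kobayashi2006DocMath, Cor. 4.2 (p. 575)] [cite: Mazur1978, Cor. 4.1] [cite: GreenbergLNM1716, §1 Conj. 1.11 (p. 62)] -/
theorem missingUpperBoundAt_of_not_surj_of_muCert_contra
    (hJs : thm61_splitMultiplicative) (hJn : thm61_nonsplitMultiplicative)
    (h12 : Kato2004.thm12_4) (hnf : exists_isNewformOf)
    (hns' : Kato2004.exists_multDivisibilityInputs_nonsplit_contra)
    (hsp' : Kato2004.exists_multDivisibilityInputs_split_contra)
    (hfine' : Kato2004.exists_multDivisibilityInputs_fine_contra) (hMz : mazur_not_dvd_maninConstant_of_odd)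
    (W : WeierstrassCurve ℚ) [W.IsElliptic] [W.IsGloballyMinimal] (p : ℕ) [Fact p.Prime]
    (hGS : W.HasSplitMultiplicativeReductionAtPrime p → greenberg_stevens (W := W) (p := p))
    (hX : ClassX11a W p) (hns : ¬ Surj W p)
    (hcert : ∀ {N : ℕ} [NeZero N] (f : CuspForm (Gamma0 N) 2), IsNewformOf W f →
        ∀ (ϖ : ℚ), (ϖ : ℝ) * W.realPeriodRat = plusPeriod f →
        ∀ (a : ℚ_[p]) (L : PowerSeries ℚ_[p]),
          (W.HasSplitMultiplicativeReductionAtPrime p → a = 1) →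
          (¬ W.HasSplitMultiplicativeReductionAtPrime p → a = -1) →
          IsMultPAdicLFunctionOf f p a L →
          ∃ n : ℕ, ‖PowerSeries.coeff n (PowerSeries.C ((ϖ : ℚ) : ℚ_[p]) * L)‖ = 1) :
    Typed.MissingUpperBoundAt W p :=
  missingUpperBoundAt_of_multDivisibilityAt_of_analyticRank_eq_zero_noGZK hJs hJn hnf W p hGS hX.ne_two hX.mult
    hX.analyticRank_eq_zero
    (multDivisibilityAt_of_katoFacts_of_muAn_contra_of_mazur nonempty_iwasawaH1Data_holds h12 hnf hns' hsp' hfine' hMz W p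
      hX.ne_two hX.mult hX.irr hns (fun f hf ϖ hϖ a L hsa hna hL => hcert f hf ϖ hϖ a L hsa hna hL))

end Summit.BirchSwinnertonDyer.Rank1Residual.ClassX11a

namespace Summit.BirchSwinnertonDyer.BirchSwinnertonDyer.Theorems.GL1Cartan

/-- **The UNIT SECTOR of U5, class-free binder form (CONDITIONAL on eight named print facts):** for every minimal `E/ℚ` in class X11a
with `ρ̄_{E,p}` not surjective, `5 ≤ p`, `p` NON-split multiplicative and `L(E,1)/Ω_E` of `p`-adic valuation `0`, `MissingUpperBoundAt W p`.
This is the first conjunct of the record's rev-9 cut of U5 (`Cruxes/UpperNonSurjFive/Lines/gl1cartan5.lean`); the binder `5 ≤ p` is carried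
for the shape of U5 and not used. [cite: MazurTateTeitelbaum1986, §I.10 and §I.14] [cite: Kato2004Asterisque, §17.13 (pp. 279–280)]
[cite: SteinWuthrich2013, Thm. 6.1 (p. 20)] [cite: Mazur1978, Cor. 4.1] -/
theorem upperNonSurjFive_on_unitSector_of_eightFacts
    (hJs : thm61_splitMultiplicative) (hJn : thm61_nonsplitMultiplicative)
    (h12 : Kato2004.thm12_4) (hnf : exists_isNewformOf)
    (hns' : Kato2004.exists_multDivisibilityInputs_nonsplit_contra)
    (hsp' : Kato2004.exists_multDivisibilityInputs_split_contra)
    (hfine' : Kato2004.exists_multDivisibilityInputs_fine_contra) (hMz : mazur_not_dvd_maninConstant_of_odd) :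
    ∀ (W : WeierstrassCurve ℚ) [W.IsElliptic] [W.IsGloballyMinimal] (p : ℕ) [Fact p.Prime],
      ClassX11a W p → ¬ Surj W p → 5 ≤ p → ¬ W.HasSplitMultiplicativeReductionAtPrime p →
      (∃ t : ℚ, W.entireLFunction 1 / (W.realPeriodRat : ℂ) = (t : ℂ) ∧ padicValRat p t = 0) →
      MissingUpperBoundAt W p := by
  intro W _ _ p _ hX hns _ hnsp ht
  obtain ⟨t, ht, hunit⟩ := ht
  exact hX.missingUpperBoundAt_of_not_surj_of_nonsplit_of_unitValue_contra hJs hJn h12 hnf hns' hsp' hfine' hMz W p hns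
    hnsp ht hunit

/-! ## §3 The headline of line «cmvalue5» REV 4 as a corollary: `p ∤ #Ш_an ⇒ Ш(E)[p] = 0` when no prime is split multiplicative -/

/-- **On X11a with no split multiplicative prime and `p ≥ 5`: `ord_p #Ш_an = ord_p (L(E,1)/Ω_E)`** (modularity + Mazur for the
existence of the rational `L(E,1)/Ω_E`, Gross–Zagier–Kolyvagin for `#Ш_an = t·#E(ℚ)²/∏ c_ℓ` in analytic rank `0`): `p ∤ #E(ℚ)` because
`E[p]` is irreducible (a rational point of order `p` spans a `Γ_ℚ`-stable line; Cauchy + Mazur 1977 III §5), and `p ∤ ∏ c_ℓ` because no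
prime is split multiplicative and `p ≥ 5` (Kodaira–Néron). [cite: Mazur1977, Ch. III §5 (p. 157)] [cite: SilvermanATAEC1994, Cor. IV.9.2 (d)]
[cite: Miller2011LMS, Def. 1.1 (arXiv:1010.2431 p. 3)] -/
theorem padicValRat_shaAn_eq_padicValRat_LOne_div (hGZK : rank_eq_analyticRank_of_analyticRank_le_one)
    (hnf : exists_isNewformOf) (hMz : mazur_not_dvd_maninConstant_of_odd)
    {W : WeierstrassCurve ℚ} [W.IsElliptic] [W.IsGloballyMinimal] {p : ℕ} [Fact p.Prime]
    (hX : ClassX11a W p) (hp5 : 5 ≤ p) (hnsm : ∀ (ℓ : ℕ) [Fact ℓ.Prime], ¬ W.HasSplitMultiplicativeReductionAtPrime ℓ)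
    {q t : ℚ} (hq : shaAn W = (q : ℂ)) (ht : W.entireLFunction 1 / (W.realPeriodRat : ℂ) = (t : ℂ)) :
    padicValRat p q = padicValRat p t := by
  have hp : p.Prime := Fact.out
  obtain ⟨t', ht', ht0', -⟩ := hX.exists_LOne_div_realPeriod_eq_of_mazur hnf hMz hp5
  have htt : t = t' := by exact_mod_cast ht.symm.trans ht'
  subst htt
  have hL1 : W.entireLFunction 1 ≠ 0 := by
    intro h0
    apply ht0'
    have h : ((t : ℚ) : ℂ) = 0 := by rw [← ht, h0, zero_div]
    exact_mod_cast h
  obtain ⟨-, hE, -, hsha⟩ := shaAn_eq_of_L_one_div_eq hGZK W hL1 ht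
  haveI := hE
  have hqq : q = t * (Nat.card W.toAffine.Point : ℚ) ^ 2 / (W.tamagawaProduct : ℚ) := by
    exact_mod_cast hq.symm.trans hsha
  subst hqq
  -- `p ∤ #E(ℚ)`: irreducible `E[p]` (Cauchy + Mazur III §5)
  have hcardE : ¬ p ∣ Nat.card W.toAffine.Point := fun hdvd =>
    not_exists_addOrderOf_eq_of_hasIrreducibleModPGaloisRep W hX.irr
      (exists_prime_addOrderOf_dvd_card' (G := W.toAffine.Point) p hdvd)
  -- `p ∤ ∏ c_ℓ`: no split multiplicative prime, `p ≥ 5`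
  have htam : ¬ p ∣ W.tamagawaProduct :=
    X11b.not_dvd_tamagawaProduct_of_forall_split W hp hp5 (fun ℓ _ hs => absurd hs (hnsm ℓ))
  have hcard0 : (Nat.card W.toAffine.Point : ℚ) ≠ 0 := by
    exact_mod_cast (Nat.card_pos (α := W.toAffine.Point)).ne'
  have htam0 : (W.tamagawaProduct : ℚ) ≠ 0 := by
    exact_mod_cast (W.tamagawaProduct_pos_holds : 0 < W.tamagawaProduct).ne'
  have hcardv : padicValRat p (Nat.card W.toAffine.Point : ℚ) = 0 := by
    rw [padicValRat.of_nat, padicValNat.eq_zero_of_not_dvd hcardE, Nat.cast_zero]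
  have htamv : padicValRat p (W.tamagawaProduct : ℚ) = 0 := by
    rw [padicValRat.of_nat, padicValNat.eq_zero_of_not_dvd htam, Nat.cast_zero]
  rw [padicValRat.div (mul_ne_zero ht0' (pow_ne_zero 2 hcard0)) htam0,
    padicValRat.mul ht0' (pow_ne_zero 2 hcard0), padicValRat.pow, hcardv, htamv]
  ring

/-- **The headline of line «cmvalue5» REV 4, from tree theorems (CONDITIONAL on eight print facts + Gross–Zagier–Kolyvagin).**  For
minimal `E/ℚ` in class X11a with `ρ̄_{E,p}` not surjective, `5 ≤ p`, NO split multiplicative prime and `p ∤ #Ш_an(E)` (`#Ш_an = q`,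
`ord_p q = 0`): `Ш(E/ℚ)[p] = 0`.  Road: `ord_p (L(E,1)/Ω_E) = ord_p #Ш_an = 0` (`padicValRat_shaAn_eq_padicValRat_LOne_div`), the unit
sector gives `ord_p #Ш ≤ ord_p #Ш_an = 0`, and a finite `Ш` (GZK on X11a) with `ord_p #Ш = 0` has no `p`-torsion
(`Typed.noPTorsion_of_padicValNat_shaOrder_eq_zero`).  The published line «cmvalue5» REV 4 (`Cruxes/UpperNonSurjFive/Lines/cmvalue5.lean`,
`UnitSectorNoPTorsion`) states this on the SMALLER locus «main locus ∧ no multiplicative `ℓ ≡ −1 (mod p)`» (a main-locus pair has no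
split multiplicative prime: `GL1Cartan.not_hasSplitMultiplicativeReductionAtPrime_of_mainLocus`) and feeds it from a CM companion, a CM
value transport and an OPEN twist-existence stub; none of that is needed modulo the eight facts.
[cite: MazurTateTeitelbaum1986, §I.10 and §I.14] [cite: Kato2004Asterisque, §17.13 (pp. 279–280)]
[cite: Mazur1977, Ch. III §5 (p. 157)] [cite: Miller2011LMS, Def. 1.1 (arXiv:1010.2431 p. 3)] -/
theorem noPTorsion_on_unitSector_of_nineFacts
    (hJs : thm61_splitMultiplicative) (hJn : thm61_nonsplitMultiplicative)
    (h12 : Kato2004.thm12_4) (hnf : exists_isNewformOf)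
    (hns' : Kato2004.exists_multDivisibilityInputs_nonsplit_contra)
    (hsp' : Kato2004.exists_multDivisibilityInputs_split_contra)
    (hfine' : Kato2004.exists_multDivisibilityInputs_fine_contra) (hMz : mazur_not_dvd_maninConstant_of_odd)
    (hGZK : rank_eq_analyticRank_of_analyticRank_le_one) :
    ∀ (W : WeierstrassCurve ℚ) [W.IsElliptic] [W.IsGloballyMinimal] (p : ℕ) [Fact p.Prime],
      ClassX11a W p → ¬ Surj W p → 5 ≤ p → (∀ (ℓ : ℕ) [Fact ℓ.Prime], ¬ W.HasSplitMultiplicativeReductionAtPrime ℓ) →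
      (∃ q : ℚ, shaAn W = (q : ℂ) ∧ padicValRat p q = 0) → ∀ x : W.sha, (p : ℤ) • x = 0 → x = 0 := by
  intro W _ _ p _ hX hns hp5 hnsm hq
  obtain ⟨q, hq, hv⟩ := hq
  obtain ⟨t, ht, -, -⟩ := hX.exists_LOne_div_realPeriod_eq_of_mazur hnf hMz hp5
  have hunit : padicValRat p t = 0 := by
    rw [← padicValRat_shaAn_eq_padicValRat_LOne_div hGZK hnf hMz hX hp5 hnsm hq ht]; exact hv
  obtain ⟨q', hq', hle⟩ := hX.missingUpperBoundAt_of_not_surj_of_nonsplit_of_unitValue_contra hJs hJn h12 hnf hns' hsp'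
    hfine' hMz W p hns (hnsm p) ht hunit
  have hqq : q' = q := by exact_mod_cast hq'.symm.trans hq
  subst hqq
  refine Typed.noPTorsion_of_padicValNat_shaOrder_eq_zero W p (hX.finite_sha hGZK) ?_
  have h0 : ((padicValNat p W.shaOrder : ℕ) : ℤ) ≤ 0 := by rw [← hv]; exact hle
  exact_mod_cast le_antisymm h0 (by exact_mod_cast Nat.zero_le _)

/-- **The same at a main-locus pair** (the literal locus of «cmvalue5» REV 4's `UnitSectorNoPTorsion`, minus its unused `ℓ ≢ −1`
clause): main locus ∧ `p ∤ #Ш_an` ⟹ `Ш(E/ℚ)[p] = 0`, modulo the eight facts + GZK — the main locus has no split multiplicative prime.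
[cite: Serre1972, §2.8] [cite: Kato2004Asterisque, §17.13 (pp. 279–280)] [cite: Miller2011LMS, Def. 1.1] -/
theorem noPTorsion_on_unitMainLocus_of_nineFacts
    (hJs : thm61_splitMultiplicative) (hJn : thm61_nonsplitMultiplicative)
    (h12 : Kato2004.thm12_4) (hnf : exists_isNewformOf)
    (hns' : Kato2004.exists_multDivisibilityInputs_nonsplit_contra)
    (hsp' : Kato2004.exists_multDivisibilityInputs_split_contra)
    (hfine' : Kato2004.exists_multDivisibilityInputs_fine_contra) (hMz : mazur_not_dvd_maninConstant_of_odd)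
    (hGZK : rank_eq_analyticRank_of_analyticRank_le_one) :
    ∀ (W : WeierstrassCurve ℚ) [W.IsElliptic] [W.IsGloballyMinimal] (p : ℕ) [Fact p.Prime],
      ClassX11a W p → ¬ Surj W p → 5 ≤ p → MainLocus W p →
      (∃ q : ℚ, shaAn W = (q : ℂ) ∧ padicValRat p q = 0) → ∀ x : W.sha, (p : ℤ) • x = 0 → x = 0 :=
  fun W _ _ p _ hX hns hp5 hL hq =>
    noPTorsion_on_unitSector_of_nineFacts hJs hJn h12 hnf hns' hsp' hfine' hMz hGZK W p hX hns hp5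
      (fun ℓ _ => not_hasSplitMultiplicativeReductionAtPrime_of_mainLocus hL ℓ) hq

end Summit.BirchSwinnertonDyer.BirchSwinnertonDyer.Theorems.GL1Cartan

end
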